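import Summits.NavierStokesRegularity.FunctionalMining.StrainWeightedBalanceC1
import Summits.NavierStokesRegularity.FunctionalMining.StrainViscous
import HarnessLib

/-!
# FunctionalMining — the exact `∫|S|^q` balance for real `q ≥ 2` and its slice form for `q > 2`

Search for candidate a priori estimates; no regularity claim. Cell `pub-nsfunc`, prove seat
(gen 10). The dynamic half of the K0 rows `ES.absS.q|T_LD|G1` at a REAL exponent `q` (SIEVELD §3.3;
`B_q = ∫|S|^q = ∫ (|S|²)^{q/2} = torusStrainMoment q`):

* `GradientTensor.hasDerivWithinAt_integral_strainSqAt_rpow` — along a classical solution of the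
  forced system on `T^d × [a, b]`, for real `q ≥ 2` (the weight `s ↦ s^{q/2}` is `C¹`,
  `Real.contDiff_rpow_const_of_le`, and the `C¹` strain balance of `StrainWeightedBalanceC1` applies):
  `dB_q/dt = qν∫(|S|²)^{q/2−1}∑SᵢⱼΔ… − q∫(|S|²)^{q/2−1}∑Sᵢⱼ∂ᵢ∂ⱼp + q∫(|S|²)^{q/2−1}∑Sᵢⱼ(∂ᵢf)ⱼ − q∫(|S|²)^{q/2−1}N`
  (`N = ∑ᵢⱼ Sᵢⱼ ∑ₖ(∂ᵢu)ₖ(∂ₖu)ⱼ`), and `…_unforced` (`f = 0`).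
* `GradientTensor.integral_rpow_mul_sum_strain_laplacian_le` — the viscous sign at a real exponent:
  for smooth `v` and `r > 0`, `∫ (|S|²)^r ∑ᵢⱼ Sᵢⱼ (∂ᵢΔv)ⱼ ≤ −∫ (|S|²)^r ∑ₖ∑ᵢⱼ (∂ₖSᵢⱼ)²` — the
  smooth-weight identity of `StrainViscous` at `g_ε(s) = (s+ε)^{r+1}/(r+1)` (its second term
  `−½∫ r(|S|²+ε)^{r−1}|∇|S|²|² ≤ 0`) and `ε → 0⁺` by continuity of parametric integrals.
* `GradientTensor.derivWithin_Bq_le` — the slice form for real `q > 2`, `ν ≥ 0`, `f = 0`: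
  `dB_q/dt ≤ −qν∫(|S|²)^{q/2−1}∑ₖ∑ᵢⱼ(∂ₖSᵢⱼ)² − q∫(|S|²)^{q/2−1}Π − q∫(|S|²)^{q/2−1}N`
  (`Π = ∑ᵢⱼSᵢⱼ∂ᵢ∂ⱼp`).
-/

noncomputable section

open MeasureTheory Finset Set Filter Topology
open scoped InnerProductSpace RealInnerProductSpace ContDiff

namespace Summit.NavierStokesRegularity.FunctionalMining

open Literature.Analysis.FunctionSpaces Literature.Analysis.FluidPDE

namespace GradientTensor

variable {d : Type*} [Fintype d] [DecidableEq d]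

/-! ## 1. The exact balance with the weight `s ↦ s^{q/2}`, real `q ≥ 2` -/

/-- **Exact `∫|S|^q` balance, real `q ≥ 2`, forced system.** Along a classical solution of
`∂ₜu + (u·∇)u = νΔu − ∇p + f`, `div u = 0` on `T^d × [a, b]` (`a < b`),
`s ↦ ∫ (|S(s)|²)^{q/2}` has, at every `t ∈ [a, b]`, the one-sided derivative
`qν∫(|S|²)^{q/2−1}∑ᵢⱼSᵢⱼ(∂ᵢΔu)ⱼ − q∫(|S|²)^{q/2−1}∑ᵢⱼSᵢⱼ∂ᵢ∂ⱼp + q∫(|S|²)^{q/2−1}∑ᵢⱼSᵢⱼ(∂ᵢf)ⱼ − q∫(|S|²)^{q/2−1}N`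
within `[a, b]` (Majda–Bertozzi (1.29) contracted with `q(|S|²)^{q/2−1}S`).
[cite: MajdaBertozziCUP2002, §1.4 eq. (1.29)] -/
theorem hasDerivWithinAt_integral_strainSqAt_rpow
    {a b ν : ℝ} {f u : ℝ → UnitAddTorus d → EuclideanSpace ℝ d} {p : ℝ → UnitAddTorus d → ℝ}
    (h : Torus.IsClassicalNSSolutionOn (Icc a b) ν f u p) (hab : a < b) {q : ℝ} (hq : 2 ≤ q)
    {t : ℝ} (ht : t ∈ Icc a b) :
    HasDerivWithinAt (fun s => ∫ x, torusStrainSqAt (u s) x ^ (q / 2))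
      (q * ν * (∫ x, torusStrainSqAt (u t) x ^ (q / 2 - 1) * ∑ i, ∑ j,
          (Torus.partialDeriv j (u t) x i + Torus.partialDeriv i (u t) x j) / 2 *
            Torus.partialDeriv i (Torus.laplacian (u t)) x j) -
        q * (∫ x, torusStrainSqAt (u t) x ^ (q / 2 - 1) * ∑ i, ∑ j,
          (Torus.partialDeriv j (u t) x i + Torus.partialDeriv i (u t) x j) / 2 *
            Torus.partialDeriv i (Torus.partialDeriv j (p t)) x) +
        q * (∫ x, torusStrainSqAt (u t) x ^ (q / 2 - 1) * ∑ i, ∑ j,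
          (Torus.partialDeriv j (u t) x i + Torus.partialDeriv i (u t) x j) / 2 *
            Torus.partialDeriv i (f t) x j) -
        q * ∫ x, torusStrainSqAt (u t) x ^ (q / 2 - 1) * ∑ i, ∑ j,
          (Torus.partialDeriv j (u t) x i + Torus.partialDeriv i (u t) x j) / 2 *
            ∑ k, Torus.partialDeriv i (u t) x k * Torus.partialDeriv k (u t) x j)
      (Icc a b) t := by
  have hp1 : (1 : ℝ) ≤ q / 2 := by linarith
  have hΨ : ContDiffOn ℝ 1 (fun y : ℝ => y ^ (q / 2)) univ :=
    (Real.contDiff_rpow_const_of_le (p := q / 2) (n := 1) (by exact_mod_cast hp1)).contDiffOn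
  have hd : ∀ y : ℝ, deriv (fun y : ℝ => y ^ (q / 2)) y = q / 2 * y ^ (q / 2 - 1) := fun y =>
    (Real.hasDerivAt_rpow_const (p := q / 2) (Or.inr hp1)).deriv
  have hD := hasDerivWithinAt_integral_comp_strainSqAt_of_contDiffOn_one h hab isOpen_univ hΨ
    (fun _ _ _ => mem_univ _) ht
  refine hD.congr_deriv ?_
  simp only [hd]
  have e1 : ∀ g : UnitAddTorus d → ℝ,
      (∫ x, q / 2 * torusStrainSqAt (u t) x ^ (q / 2 - 1) * g x) =
        q / 2 * ∫ x, torusStrainSqAt (u t) x ^ (q / 2 - 1) * g x := by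
    intro g
    rw [← integral_const_mul]
    exact integral_congr_ae (ae_of_all _ fun x => by ring)
  rw [e1, e1, e1, e1]
  ring

/-- **Unforced case, real `q ≥ 2`**: along a classical solution of the unforced system (`f = 0`,
any `ν`) on `T^d × [a, b]`, `s ↦ ∫ (|S(s)|²)^{q/2}` has the one-sided derivative
`qν∫(|S|²)^{q/2−1}∑ᵢⱼSᵢⱼ(∂ᵢΔu)ⱼ − q∫(|S|²)^{q/2−1}∑ᵢⱼSᵢⱼ∂ᵢ∂ⱼp − q∫(|S|²)^{q/2−1}N` within `[a, b]`.
[cite: MajdaBertozziCUP2002, §1.4 eq. (1.29)] -/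
theorem hasDerivWithinAt_integral_strainSqAt_rpow_unforced
    {a b ν : ℝ} {u : ℝ → UnitAddTorus d → EuclideanSpace ℝ d} {p : ℝ → UnitAddTorus d → ℝ}
    (h : Torus.IsClassicalNSSolutionOn (Icc a b) ν 0 u p) (hab : a < b) {q : ℝ} (hq : 2 ≤ q)
    {t : ℝ} (ht : t ∈ Icc a b) :
    HasDerivWithinAt (fun s => ∫ x, torusStrainSqAt (u s) x ^ (q / 2))
      (q * ν * (∫ x, torusStrainSqAt (u t) x ^ (q / 2 - 1) * ∑ i, ∑ j,
          (Torus.partialDeriv j (u t) x i + Torus.partialDeriv i (u t) x j) / 2 *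
            Torus.partialDeriv i (Torus.laplacian (u t)) x j) -
        q * (∫ x, torusStrainSqAt (u t) x ^ (q / 2 - 1) * ∑ i, ∑ j,
          (Torus.partialDeriv j (u t) x i + Torus.partialDeriv i (u t) x j) / 2 *
            Torus.partialDeriv i (Torus.partialDeriv j (p t)) x) -
        q * ∫ x, torusStrainSqAt (u t) x ^ (q / 2 - 1) * ∑ i, ∑ j,
          (Torus.partialDeriv j (u t) x i + Torus.partialDeriv i (u t) x j) / 2 *
            ∑ k, Torus.partialDeriv i (u t) x k * Torus.partialDeriv k (u t) x j)
      (Icc a b) t := by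
  have hD := hasDerivWithinAt_integral_strainSqAt_rpow h hab hq ht
  refine hD.congr_deriv ?_
  have h0 : ∀ x, ∑ i, ∑ j,
      (Torus.partialDeriv j (u t) x i + Torus.partialDeriv i (u t) x j) / 2 *
        Torus.partialDeriv i ((0 : ℝ → UnitAddTorus d → EuclideanSpace ℝ d) t) x j = 0 := by
    intro x
    have h0' : ∀ i, Torus.partialDeriv i (0 : UnitAddTorus d → EuclideanSpace ℝ d) x = 0 := by
      intro i
      simp [Torus.partialDeriv, Torus.lineDeriv]
    simp [h0']
  simp only [h0, mul_zero, integral_zero, add_zero]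

/-! ## 2. The viscous term at a real exponent -/

omit [DecidableEq d] in
/-- Continuity of `ε ↦ ∫_{T^d} F(ε, x) dx` for jointly continuous `F`. [folklore] -/
private theorem continuous_integral_param_strain {F : ℝ → UnitAddTorus d → ℝ}
    (hF : Continuous (Function.uncurry F)) : Continuous fun ε => ∫ x, F ε x := by
  have h := continuous_parametric_integral_of_continuous (μ := volume) hF isCompact_univ
  simpa only [Measure.restrict_univ] using h

omit [Fintype d] [DecidableEq d] in
/-- Passing to `ε → 0⁺` in `0 ≤ φ ε` (`0 < ε ≤ 1`) with `φ` continuous at `0`. [folklore] -/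
private theorem nonneg_of_forall_pos_of_continuousAt_strain {φ : ℝ → ℝ} (hφ : ContinuousAt φ 0)
    (h : ∀ ε : ℝ, 0 < ε → ε ≤ 1 → 0 ≤ φ ε) : 0 ≤ φ 0 := by
  have ht : Tendsto φ (𝓝[>] 0) (𝓝 (φ 0)) := hφ.tendsto.mono_left nhdsWithin_le_nhds
  refine ge_of_tendsto ht ?_
  have hmem : Ioo (0 : ℝ) 1 ∈ 𝓝[>] (0 : ℝ) := Ioo_mem_nhdsGT one_pos
  filter_upwards [hmem] with ε hε using h ε hε.1 hε.2.le

/-- **Sign of the viscous term of the `∫|S|^q` balance at a real exponent.** For smooth `v` on `T^d`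
and `r > 0`:
`∫ (|S|²)^r ∑ᵢⱼ Sᵢⱼ (∂ᵢΔv)ⱼ ≤ −∫ (|S|²)^r ∑ₖ∑ᵢⱼ (∂ₖSᵢⱼ)²`
— the smooth-weight identity `integral_deriv_comp_strainSqAt_mul_sum_strain_laplacian` at
`g_ε(s) = (s+ε)^{r+1}/(r+1)` on `Ioi (−ε)`, whose second term `−½∫ r(|S|²+ε)^{r−1}∑ₖ(∂ₖ|S|²)²` is
nonpositive, and `ε → 0⁺`. [ours] -/
theorem integral_rpow_mul_sum_strain_laplacian_le {v : UnitAddTorus d → EuclideanSpace ℝ d}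
    (hv : Torus.IsSmooth v) {r : ℝ} (hr : 0 < r) :
    ∫ x, torusStrainSqAt v x ^ r * ∑ i, ∑ j,
        (Torus.partialDeriv j v x i + Torus.partialDeriv i v x j) / 2 *
          Torus.partialDeriv i (Torus.laplacian v) x j ≤
      -∫ x, torusStrainSqAt v x ^ r * ∑ k, ∑ i, ∑ j,
          ((Torus.partialDeriv k (Torus.partialDeriv j v) x i +
            Torus.partialDeriv k (Torus.partialDeriv i v) x j) / 2) ^ 2 := by
  -- the two continuous densities
  have hE : ∀ i j, Torus.IsSmooth
      (fun y => (Torus.partialDeriv j v y i + Torus.partialDeriv i v y j) / 2) :=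
    fun i j => isSmooth_strainEntry hv i j
  have hQs : Torus.IsSmooth (torusStrainSqAt v) := isSmooth_strainSqAt hv
  have hQ : Continuous (torusStrainSqAt v) := hQs.continuous
  have hQ0 : ∀ x, 0 ≤ torusStrainSqAt v x := torusStrainSqAt_nonneg v
  set h₁ : UnitAddTorus d → ℝ := fun x => ∑ i, ∑ j,
    (Torus.partialDeriv j v x i + Torus.partialDeriv i v x j) / 2 *
      Torus.partialDeriv i (Torus.laplacian v) x j with hh₁
  set h₂ : UnitAddTorus d → ℝ := fun x => ∑ k, ∑ i, ∑ j,
    ((Torus.partialDeriv k (Torus.partialDeriv j v) x i +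
      Torus.partialDeriv k (Torus.partialDeriv i v) x j) / 2) ^ 2 with hh₂
  have hc₁ : Continuous h₁ := continuous_finsetSum _ fun i _ => continuous_finsetSum _ fun j _ =>
    (hE i j).continuous.mul ((hv.laplacian.partialDeriv i).apply j).continuous
  have hc₂ : Continuous h₂ := continuous_finsetSum _ fun k _ => continuous_finsetSum _ fun i _ =>
    continuous_finsetSum _ fun j _ =>
      (((((hv.partialDeriv j).partialDeriv k).apply i).add
        (((hv.partialDeriv i).partialDeriv k).apply j)).continuous.div_const _).pow 2
  -- the parametric integrals
  set F : ℝ → ℝ := fun ε => ∫ x, (torusStrainSqAt v x + ε) ^ r * h₁ x with hF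
  set G : ℝ → ℝ := fun ε => ∫ x, (torusStrainSqAt v x + ε) ^ r * h₂ x with hG
  have hpow : Continuous fun p : ℝ × UnitAddTorus d => (torusStrainSqAt v p.2 + p.1) ^ r :=
    ((hQ.comp continuous_snd).add continuous_fst).rpow_const fun p => Or.inr hr.le
  have hFc : Continuous F := continuous_integral_param_strain (hpow.mul (hc₁.comp continuous_snd))
  have hGc : Continuous G := continuous_integral_param_strain (hpow.mul (hc₂.comp continuous_snd))
  -- the identity at `ε > 0`
  have hε : ∀ ε : ℝ, 0 < ε → ε ≤ 1 → 0 ≤ -G ε - F ε := by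
    intro ε hε _
    set g : ℝ → ℝ := fun s => (s + ε) ^ (r + 1) / (r + 1) with hg
    have hr1 : (1 : ℝ) ≤ r + 1 := by linarith
    have hpos : ∀ x, 0 < torusStrainSqAt v x + ε := fun x => by linarith [hQ0 x]
    have hU : IsOpen (Ioi (-ε)) := isOpen_Ioi
    have hmaps : ∀ x, torusStrainSqAt v x ∈ Ioi (-ε) := fun x => by
      show -ε < torusStrainSqAt v x; linarith [hQ0 x]
    have hgs : ContDiffOn ℝ ∞ g (Ioi (-ε)) := by
      intro y hy
      have hy' : y + ε ≠ 0 := by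
        have : -ε < y := hy
        linarith
      exact (((contDiffAt_id.add contDiffAt_const).rpow_const_of_ne hy').div_const _).contDiffWithinAt
    -- `g' = (s+ε)^r` everywhere, `g'' = r(s+ε)^{r-1}` on `Ioi (-ε)`
    have hd1 : deriv g = fun y => (y + ε) ^ r := by
      funext y
      have h := ((hasDerivAt_id' y).add_const ε).rpow_const (p := r + 1) (Or.inr hr1)
      have h' : HasDerivAt g ((1 * (r + 1) * (y + ε) ^ (r + 1 - 1)) / (r + 1)) y := h.div_const _
      rw [h'.deriv, add_sub_cancel_right]
      have hr1' : r + 1 ≠ 0 := by linarith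
      field_simp
    have hd2 : ∀ y : ℝ, 0 < y + ε → deriv (deriv g) y = r * (y + ε) ^ (r - 1) := by
      intro y hy
      rw [hd1]
      have h := ((hasDerivAt_id' y).add_const ε).rpow_const (p := r) (Or.inl hy.ne')
      rw [h.deriv]; ring
    have hid := integral_deriv_comp_strainSqAt_mul_sum_strain_laplacian hv hU hgs hmaps
    rw [hd1] at hid
    -- the second term is nonnegative
    have hB : 0 ≤ ∫ x, deriv (fun y => (y + ε) ^ r) (torusStrainSqAt v x) *
        ∑ k, Torus.partialDeriv k (torusStrainSqAt v) x ^ 2 := by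
      refine integral_nonneg fun x => ?_
      have e : deriv (fun y => (y + ε) ^ r) (torusStrainSqAt v x) =
          r * (torusStrainSqAt v x + ε) ^ (r - 1) := by
        have := hd2 (torusStrainSqAt v x) (hpos x)
        rwa [hd1] at this
      rw [e]
      exact mul_nonneg (mul_nonneg hr.le (Real.rpow_nonneg (hpos x).le _))
        (Finset.sum_nonneg fun k _ => sq_nonneg _)
    have hFε : F ε = ∫ x, (torusStrainSqAt v x + ε) ^ r * h₁ x := rfl
    have hGε : G ε = ∫ x, (torusStrainSqAt v x + ε) ^ r * h₂ x := rfl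
    rw [hFε, hGε]
    simp only [hh₁, hh₂]
    have h2 : (0 : ℝ) < 2⁻¹ := by norm_num
    nlinarith [hid, hB]
  -- `ε → 0⁺`
  have hφ : ContinuousAt (fun ε => -G ε - F ε) 0 := (hGc.neg.sub hFc).continuousAt
  have h0 := nonneg_of_forall_pos_of_continuousAt_strain hφ hε
  have hF0 : F 0 = ∫ x, torusStrainSqAt v x ^ r * h₁ x := by simp only [hF, add_zero]
  have hG0 : G 0 = ∫ x, torusStrainSqAt v x ^ r * h₂ x := by simp only [hG, add_zero]
  simp only [hF0, hG0, hh₁, hh₂] at h0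
  linarith

/-! ## 3. The slice form of the `∫|S|^q` balance, real `q > 2` -/

/-- **Slice form of the `∫|S|^q` balance, real `q > 2`** (`hasDerivWithinAt_integral_strainSqAt_rpow_unforced`
+ the viscous sign `integral_rpow_mul_sum_strain_laplacian_le` at `r = q/2 − 1 > 0`): along a
classical solution of the unforced system on `[a, b] × T^d` with `ν ≥ 0`,
`s ↦ B_q(s) = ∫(|S(s)|²)^{q/2}` is differentiable within `[a, b]` at `t` and
`dB_q/dt ≤ −qν∫(|S|²)^{q/2−1}∑ₖ∑ᵢⱼ(∂ₖSᵢⱼ)² − q∫(|S|²)^{q/2−1}∑ᵢⱼSᵢⱼ∂ᵢ∂ⱼp − q∫(|S|²)^{q/2−1}N`.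
[ours] -/
theorem derivWithin_Bq_le {a b ν : ℝ} (hab : a < b) (hν : 0 ≤ ν)
    {u : ℝ → UnitAddTorus d → EuclideanSpace ℝ d} {p : ℝ → UnitAddTorus d → ℝ}
    (hsol : Torus.IsClassicalNSSolutionOn (Icc a b) ν 0 u p) {q : ℝ} (hq : 2 < q) {t : ℝ}
    (ht : t ∈ Icc a b) :
    DifferentiableWithinAt ℝ (fun s => ∫ x, torusStrainSqAt (u s) x ^ (q / 2)) (Icc a b) t ∧
      derivWithin (fun s => ∫ x, torusStrainSqAt (u s) x ^ (q / 2)) (Icc a b) t ≤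
        -(q * ν * ∫ x, torusStrainSqAt (u t) x ^ (q / 2 - 1) * ∑ k, ∑ i, ∑ j,
            ((Torus.partialDeriv k (Torus.partialDeriv j (u t)) x i +
              Torus.partialDeriv k (Torus.partialDeriv i (u t)) x j) / 2) ^ 2) -
          q * (∫ x, torusStrainSqAt (u t) x ^ (q / 2 - 1) * ∑ i, ∑ j,
            (Torus.partialDeriv j (u t) x i + Torus.partialDeriv i (u t) x j) / 2 *
              Torus.partialDeriv i (Torus.partialDeriv j (p t)) x) -
          q * ∫ x, torusStrainSqAt (u t) x ^ (q / 2 - 1) * ∑ i, ∑ j,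
            (Torus.partialDeriv j (u t) x i + Torus.partialDeriv i (u t) x j) / 2 *
              ∑ k, Torus.partialDeriv i (u t) x k * Torus.partialDeriv k (u t) x j := by
  have hut : Torus.IsSmooth (u t) := hsol.smooth_velocity.isSmooth_slice ht
  have hD := hasDerivWithinAt_integral_strainSqAt_rpow_unforced hsol hab hq.le ht
  have hUD : UniqueDiffWithinAt ℝ (Icc a b) t := uniqueDiffOn_Icc hab t ht
  refine ⟨hD.differentiableWithinAt, ?_⟩
  rw [hD.derivWithin hUD]
  have hr : 0 < q / 2 - 1 := by linarith
  have hV := integral_rpow_mul_sum_strain_laplacian_le hut hr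
  obtain ⟨I, hI⟩ : ∃ I : ℝ, I = ∫ x, torusStrainSqAt (u t) x ^ (q / 2 - 1) * ∑ k, ∑ i, ∑ j,
      ((Torus.partialDeriv k (Torus.partialDeriv j (u t)) x i +
        Torus.partialDeriv k (Torus.partialDeriv i (u t)) x j) / 2) ^ 2 := ⟨_, rfl⟩
  obtain ⟨V, hVdef⟩ : ∃ V : ℝ, V = ∫ x, torusStrainSqAt (u t) x ^ (q / 2 - 1) * ∑ i, ∑ j,
      (Torus.partialDeriv j (u t) x i + Torus.partialDeriv i (u t) x j) / 2 *
        Torus.partialDeriv i (Torus.laplacian (u t)) x j := ⟨_, rfl⟩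
  rw [← hI, ← hVdef] at hV ⊢
  have hq0 : 0 ≤ q * ν := by nlinarith
  nlinarith [mul_le_mul_of_nonneg_left hV hq0]

end GradientTensor

end Summit.NavierStokesRegularity.FunctionalMining
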